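import Literature.Topology.FourManifolds.PropertyRTraceClosing
import Literature.Topology.FourManifolds.OneOneHandlebodyBoundary
import Literature.Topology.FourManifolds.SmoothEmbeddingCriteria
import Literature.Topology.FourManifolds.KnotsProofs
import HarnessLib

/-!
# Stub `stub_propertyRGluing` of line `exchange-recognition`
# for crux `ConvexBisection.AcyclicBisectionRigidity`
(item stmt-SmoothPoincare4-10507, route route-SmoothPoincare4-ConvexBisection)

**Property R closes the trace, gluing form.**  A closed smooth `4`-manifold `X = P ∪_φ V` glued
from a compact `P` carrying a Morse function adapted to `∂P` with indices `≤ 2`, one critical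
point of index `0`, none of index `1` and one of index `2` (a knot trace `X_n(K) = 𝔻⁴ ∪_K h²`,
Milnor 1963, Thm. 3.2) and a compact connected orientable `V` carrying an adapted Morse function
with indices `≤ 1` and profile `(1,1)` (`V ≅ S¹ × B³`) is diffeomorphic to `S⁴` — the case
`n = 1` of Gompf–Scharlemann–Thompson 2010, Prop. 9.2 (= Gabai's Property R +
Laudenbach–Poénaru), VERBATIM the registered stub `stub_propertyRClosing` of crux 4's line
`property-r-mazur-halves` (item stmt-SmoothPoincare4-3546).

PROVED here CONDITIONALLY on three named facts of the tree (all `def … : Prop` of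
`Literature/Topology/FourManifolds`, fed in as leading hypotheses, no `def` in this file):
* `hPR : isUnknot_of_isIntegralSurgery_zero` — GABAI'S PROPERTY R (spc4.S25, `SurgeryGluck.lean`;
  Gabai 1987, Cor. 8.3; reduced in-tree to the genus clause of Cor. 8.3 by
  `isUnknot_of_isIntegralSurgery_zero_of_gabai_of_disc` and the PROVED
  `Knot.isUnknot_of_hasSeifertSurfaceOfGenus_zero_holds`);
* `hLP : exists_diffeomorph_comp_incl_eq.{0}` — LAUDENBACH–POÉNARU's extension theorem
  (spc4.S24 (c), `SPC4Handles.lean`; reduced in-tree to Lemma 2, Cerf's `Γ₄ = 0` and Thm. A in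
  positive genus, `exists_diffeomorph_comp_incl_eq_holds_of`);
* `hT : exists_framedKnot_of_hasHandleDecomposition_oneZeroOne` — the TRACE BRIDGE
  (`PropertyRTraceClosing.lean`; Kirby 1989, Ch. I §§1–2, GST §2, Milnor 1963, Thms. 3.1–3.2): a
  `(1,0,1)`-handlebody `P` is the trace of a framed knot `(K, n)`, `∂P = S³ₙ(K)`
  (`IsIntegralSurgery (𝓡 3) bP.carrier K n`), and the `0`-framed unknot closes up to
  `S⁴ = P ∪ (1,1)`-handlebody.
The fourth leaf, `nonempty_diffeomorph_boundary_sphereTwo_prod_of_handleCount_one_one` (the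
boundary of a compact connected orientable `(1,1)`-handlebody is `S² × S¹`; Kirby 1989, Ch. I §2,
p. 8), is a THEOREM of the tree (`…_holds`, `OneOneHandlebodyBoundary.lean`) and is consumed, not
assumed.

Proof.  (1) Morse bookkeeping: the adapted Morse functions are handle decompositions of types
`(1, 0, 1, 0, …)` and `handleCount 1 1` (`Handles.lean`: the predicates ARE Morse-theoretic; no
critical point of index `≥ 3`, resp. `≥ 2`, since the indices are bounded).  (2) The Property R
half `propertyR_exists_isBoundaryGluing_sphere_four` of `PropertyRTraceClosing.lean` from `hT`,
`hPR` and the boundary theorem (`propertyR_half_of_propertyR`): `∂P = S³ₙ(K) ≅ ∂V ≅ S² × S¹`,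
so `H₁(∂P) ≅ ℤ` and `n = 0` (`IsIntegralSurgery.nonempty_addEquiv_singularHomology_one_int_iff`);
the surgery presentation of `∂P` is TRANSPORTED to Mathlib's product manifold `S² × S¹` — across
the two models `𝓡 3` and `(𝓡 2).prod (𝓡 1)`, which live on different (isomorphic) vector spaces, the
obstacle recorded in `PropertyRTraceClosing.lean` — by `isOpenGluing_of_diffeomorph_of_boundaryless`
below (an open smooth embedding followed by a diffeomorphism of boundaryless manifolds is an open
smooth embedding: it is a globally defined partial diffeomorphism onto its range,
`isSmoothEmbedding_of_openPartialHomeomorph`); then `hPR` makes `K` the unknot and `hT` closes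
`P` up inside the round `S⁴ = P ∪_{φ'} V'`.  (3) GST Prop. 9.2 for one `2`-handle, the tree's
`nonempty_diffeomorph_sphere_of_isBoundaryGluing_oneTwoHandle_of_facts`: `V ≅ V'` by UNIQ₄
(`nonempty_diffeomorph_of_hasHandleDecomposition_handleCount_one_holds`, PROVED) and "it makes no
difference how the 3- and 4-handles are attached" (`hLP` with uniqueness of gluings,
`nonempty_diffeomorph_of_isBoundaryGluing_of_laudenbachPoenaru_of_diffeomorph`, PROVED).

## References

* R. E. Gompf, M. Scharlemann, A. Thompson, Geom. Topol. 14 (2010), Thm. 1.1, §2, Prop. 9.2 and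
  its proof. [GompfScharlemannThompson2010]
* D. Gabai, J. Differential Geom. 26 (1987), Cor. 8.3, Remark 8.5. [GabaiJDG1987]
* F. Laudenbach, V. Poénaru, Bull. Soc. Math. France 100 (1972) 337–344. [LaudenbachPoenaruBSMF1972]
* R. C. Kirby, *The topology of 4-manifolds*, LNM 1374 (1989), Ch. I §§1–2. [Kirby1989]
* J. Milnor, *Morse theory* (1963), Thms. 3.1–3.2. [Milnor1963]
* A. A. Kosinski, *Differential Manifolds* (1993), VI §1 (gluing), VII (handles). [Kosinski1993]
-/

noncomputable section

-- the prescribed namespace `Summit.<P>.<Sub>.…` duplicates `SmoothPoincare4` (P = Sub)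
set_option linter.dupNamespace false

open scoped Manifold ContDiff Topology ContinuousMap
open Set Function Literature.Topology.FourManifolds

namespace Summit.SmoothPoincare4.SmoothPoincare4.Theorems.AcyclicBisectionRigidity.ExchangeRecognition

/-! ### (1) Morse bookkeeping: adapted Morse functions with bounded indices -/

/-- **A `(1,0,1)` two-handlebody has a handle decomposition of type `(1, 0, 1, 0, …)`**: the
handle-decomposition predicate of the tree is Morse-theoretic (`HasHandleDecomposition`: an adapted
Morse function with prescribed critical-point counts), and an adapted Morse function with indices
`≤ 2` has no critical point of index `≥ 3` (Milnor 1963, Thms. 3.2, 3.5).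
[cite: Milnor1963, Thms. 3.2 and 3.5] -/
theorem hasHandleDecomposition_oneZeroOne {P : Type} [TopologicalSpace P]
    [ChartedSpace (EuclideanHalfSpace 4) P] {g : P → ℝ} (hg : IsMorseAdapted (𝓡∂ 4) g)
    (hle : ∀ z, IsMCriticalPt (𝓡∂ 4) g z → morseIndex (𝓡∂ 4) g z ≤ 2)
    (h0 : (criticalSetOfIndex (𝓡∂ 4) g 0).ncard = 1) (h1 : criticalSetOfIndex (𝓡∂ 4) g 1 = ∅)
    (h2 : (criticalSetOfIndex (𝓡∂ 4) g 2).ncard = 1) :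
    HasHandleDecomposition 3 P (fun k => if k = 0 then 1 else if k = 2 then 1 else 0) := by
  refine ⟨g, hg, fun k => ?_⟩
  rcases Nat.lt_or_ge k 3 with hk | hk
  · interval_cases k
    · simpa using h0
    · simp [h1]
    · simpa using h2
  · have hempty : criticalSetOfIndex (𝓡∂ 4) g k = ∅ := by
      ext z
      simp only [mem_criticalSetOfIndex, mem_empty_iff_false, iff_false, not_and]
      intro hz hk'
      have := hle z hz
      omega
    simp [hempty, show k ≠ 0 by omega, show k ≠ 2 by omega]

/-- **A `(1,1)` one-handlebody has a handle decomposition of type `handleCount 1 1`** (same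
bookkeeping: indices `≤ 1`, so no critical point of index `≥ 2`; Milnor 1963, Thms. 3.2, 3.5).
[cite: Milnor1963, Thms. 3.2 and 3.5] -/
theorem hasHandleDecomposition_oneOne {V : Type} [TopologicalSpace V]
    [ChartedSpace (EuclideanHalfSpace 4) V] {f : V → ℝ} (hf : IsMorseAdapted (𝓡∂ 4) f)
    (hle : ∀ z, IsMCriticalPt (𝓡∂ 4) f z → morseIndex (𝓡∂ 4) f z ≤ 1)
    (h0 : (criticalSetOfIndex (𝓡∂ 4) f 0).ncard = 1)
    (h1 : (criticalSetOfIndex (𝓡∂ 4) f 1).ncard = 1) :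
    HasHandleDecomposition 3 V (handleCount 1 1) := by
  refine ⟨f, hf, fun k => ?_⟩
  rcases Nat.lt_or_ge k 2 with hk | hk
  · interval_cases k
    · simpa using h0
    · simpa using h1
  · have hempty : criticalSetOfIndex (𝓡∂ 4) f k = ∅ := by
      ext z
      simp only [mem_criticalSetOfIndex, mem_empty_iff_false, iff_false, not_and]
      intro hz hk'
      have := hle z hz
      omega
    rw [hempty, ncard_empty, handleCount_of_two_le 1 1 hk]

/-! ### (2a) Transport of open gluings and surgery presentations across models -/

section Transport

variable {EA HA EB HB EP HP EP' HP' : Type*}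
  [NormedAddCommGroup EA] [NormedSpace ℝ EA] [TopologicalSpace HA] {IA : ModelWithCorners ℝ EA HA}
  [NormedAddCommGroup EB] [NormedSpace ℝ EB] [TopologicalSpace HB] {IB : ModelWithCorners ℝ EB HB}
  [NormedAddCommGroup EP] [NormedSpace ℝ EP] [TopologicalSpace HP] {IP : ModelWithCorners ℝ EP HP}
  [NormedAddCommGroup EP'] [NormedSpace ℝ EP'] [TopologicalSpace HP']
  {IP' : ModelWithCorners ℝ EP' HP'}
  {A B P P' : Type*} [TopologicalSpace A] [ChartedSpace HA A] [TopologicalSpace B]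
  [ChartedSpace HB B] [TopologicalSpace P] [ChartedSpace HP P] [TopologicalSpace P']
  [ChartedSpace HP' P']

/-- **An open smooth embedding followed by a diffeomorphism is an open smooth embedding**, for
boundaryless source and (new) target whose model vector spaces are identified by `L : EA ≃L EP'`
(the models of `P` and `P'` may live on different vector spaces): `e ∘ j` is a globally defined
partial diffeomorphism onto its open range — its inverse `j⁻¹ ∘ e⁻¹` is smooth on the range
(`contMDiffOn_symm_of_isSmoothEmbedding`) — hence a smooth embedding
(`isSmoothEmbedding_of_openPartialHomeomorph`; Lee 2013, Prop. 5.2).  Mathlib has no composition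
of smooth embeddings yet (`proof_wanted Manifold.IsSmoothEmbedding.comp`). [folklore] -/
theorem isSmoothEmbedding_diffeomorph_comp_of_isOpen_range [IA.Boundaryless] [IP'.Boundaryless]
    [IsManifold IA ∞ A] [IsManifold IP' ∞ P'] {j : A → P}
    (hj : Manifold.IsSmoothEmbedding IA IP ∞ j) (ho : IsOpen (range j)) (e : P ≃ₘ⟮IP, IP'⟯ P')
    (L : EA ≃L[ℝ] EP') :
    Manifold.IsSmoothEmbedding IA IP' ∞ (e ∘ j) ∧ IsOpen (range (e ∘ j)) := by
  have hoj : Topology.IsOpenEmbedding j := ⟨hj.isEmbedding, ho⟩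
  have hoe : Topology.IsOpenEmbedding (e ∘ j) := e.toHomeomorph.isOpenEmbedding.comp hoj
  refine ⟨?_, hoe.isOpen_range⟩
  rcases isEmpty_or_nonempty A with hA | hA
  · exact ⟨Manifold.IsImmersionOfComplement.isImmersion (F := Unit) fun x ↦ isEmptyElim x,
      hoe.isEmbedding⟩
  set Φ := hoe.toOpenPartialHomeomorph (e ∘ j) with hΦdef
  have hΦ : ContMDiffOn IA IP' ∞ Φ Φ.source := (e.contMDiff.comp hj.contMDiff).contMDiffOn
  -- the inverse `j⁻¹ ∘ e⁻¹` is smooth on the range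
  have h1 : ContMDiffOn IP IA ∞ (hoj.toOpenPartialHomeomorph j).symm (range j) :=
    contMDiffOn_symm_of_isSmoothEmbedding hj hoj
  have h2 : ContMDiffOn IP' IA ∞ ((hoj.toOpenPartialHomeomorph j).symm ∘ e.symm)
      (range (e ∘ j)) :=
    h1.comp e.symm.contMDiff.contMDiffOn fun y hy => by
      obtain ⟨a, rfl⟩ := hy
      exact ⟨a, by simp⟩
  have hΦ' : ContMDiffOn IP' IA ∞ Φ.symm Φ.target := by
    rw [hΦdef, Topology.IsOpenEmbedding.toOpenPartialHomeomorph_target]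
    refine h2.congr fun y hy => ?_
    obtain ⟨a, rfl⟩ := hy
    rw [Topology.IsOpenEmbedding.toOpenPartialHomeomorph_left_inv, comp_apply, comp_apply,
      Diffeomorph.symm_apply_apply, Topology.IsOpenEmbedding.toOpenPartialHomeomorph_left_inv]
  exact isSmoothEmbedding_of_openPartialHomeomorph Φ hoe.toOpenPartialHomeomorph_source hΦ hΦ' L

/-- **Open gluings are transported along diffeomorphisms onto boundaryless manifolds with any
model on an isomorphic vector space** (compose the two gluing embeddings with `e`; Kosinski 1993,
VI §1, proof of Thm. (1.1)).  The tree's `IsOpenGluing.of_diffeomorph_of_range_eq`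
(`ConnectedSumTransportProofs.lean`) keeps one vector space for both models of `P`, `P'`; here the
pieces are boundaryless and the models of `P'` and of the pieces are compared through
`LA : EA ≃L EP'`, `LB : EB ≃L EP'`. [cite: Kosinski1993, VI §1, Thm. (1.1)] -/
theorem isOpenGluing_of_diffeomorph_of_boundaryless [IA.Boundaryless] [IB.Boundaryless]
    [IP'.Boundaryless] [IsManifold IA ∞ A] [IsManifold IB ∞ B] [IsManifold IP' ∞ P']
    {R : A → B → Prop} (h : IsOpenGluing IA IB IP (P := P) R) (e : P ≃ₘ⟮IP, IP'⟯ P')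
    (LA : EA ≃L[ℝ] EP') (LB : EB ≃L[ℝ] EP') : IsOpenGluing IA IB IP' (P := P') R := by
  obtain ⟨jA, jB, hA, hAo, hB, hBo, hU, hR⟩ := h
  obtain ⟨hA', hAo'⟩ := isSmoothEmbedding_diffeomorph_comp_of_isOpen_range hA hAo e LA
  obtain ⟨hB', hBo'⟩ := isSmoothEmbedding_diffeomorph_comp_of_isOpen_range hB hBo e LB
  refine ⟨e ∘ jA, e ∘ jB, hA', hAo', hB', hBo', ?_, fun a b => ?_⟩
  · rw [range_comp, range_comp, ← image_union, hU, image_univ]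
    exact e.surjective.range_eq
  · rw [comp_apply, comp_apply, ← hR a b]
    exact ⟨fun h => e.injective h, fun h => congrArg e h⟩

end Transport

/-- The model vector space `ℝ³` of `𝓡 3` and the model vector space `ℝ² × ℝ¹` of
`(𝓡 2).prod (𝓡 1)` are isomorphic (both have dimension `3`). [folklore] -/
theorem nonempty_continuousLinearEquiv_euclidean_three_prod :
    Nonempty
      (EuclideanSpace ℝ (Fin 3) ≃L[ℝ] (EuclideanSpace ℝ (Fin 2) × EuclideanSpace ℝ (Fin 1))) :=
  ⟨ContinuousLinearEquiv.ofFinrankEq (by simp)⟩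

/-- **Surgery presentations modelled on `𝓡 3` are transported to Mathlib's product manifold
`S² × S¹`** (model `(𝓡 2).prod (𝓡 1)`): if `Y` (modelled on `ℝ³`) is `m`-surgery on `K` and
`Y ≅ S² × S¹`, then `S² × S¹` is `m`-surgery on `K` — the tubular neighbourhood and its framing are
kept, the open gluing is transported by `isOpenGluing_of_diffeomorph_of_boundaryless` (the knot
complement is modelled on `ℝ³`, the open solid torus on `ℝ² × ℝ¹`).  This is the cross-model
transport that `PropertyRTraceClosing.lean` records as absent (there surgery presentations move
only along diffeomorphisms of equally modelled manifolds,
`IsIntegralSurgery.of_diffeomorph_of_boundaryless`). Rolfsen 1976, §9.F (surgery is defined up to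
diffeomorphism). [folklore] -/
theorem isIntegralSurgery_sphereTwo_prod_sphereOne_of_diffeomorph {Y : Type*} [TopologicalSpace Y]
    [ChartedSpace (EuclideanSpace ℝ (Fin 3)) Y] {K : Knot} {m : ℤ}
    (h : IsIntegralSurgery (𝓡 3) Y K m)
    (e : Y ≃ₘ⟮𝓡 3, (𝓡 2).prod (𝓡 1)⟯
      (Metric.sphere (0 : EuclideanSpace ℝ (Fin 3)) 1 × Metric.sphere (0 : EuclideanSpace ℝ (Fin 2)) 1)) :
    IsIntegralSurgery ((𝓡 2).prod (𝓡 1))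
      (Metric.sphere (0 : EuclideanSpace ℝ (Fin 3)) 1 × Metric.sphere (0 : EuclideanSpace ℝ (Fin 2)) 1)
      K m := by
  obtain ⟨ν, hν, hG⟩ := h
  obtain ⟨LA⟩ := nonempty_continuousLinearEquiv_euclidean_three_prod
  exact ⟨ν, hν,
    isOpenGluing_of_diffeomorph_of_boundaryless hG e LA (ContinuousLinearEquiv.refl ℝ _)⟩

/-! ### (2b) The Property R half of GST Prop. 9.2 (`n = 1`) from Property R and the trace bridge -/

/-- **The Property R half from Gabai's Property R (product-model form) and the trace bridge.**
GIVEN `hT` (`∂P = S³ₙ(K)` and the `0`-framed unknot closes up to `S⁴`) and Property R `hPR`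
(`isUnknot_of_isIntegralSurgery_zero`: if `S² × S¹` is `0`-surgery on `K` then `K` is the unknot),
and using the tree's theorem `∂(S¹ × B³) = S² × S¹`
(`nonempty_diffeomorph_boundary_sphereTwo_prod_of_handleCount_one_one_holds`), the named fact
`propertyR_exists_isBoundaryGluing_sphere_four` of `PropertyRTraceClosing.lean` holds:
`∂P = S³ₙ(K) ≅ ∂V ≅ S² × S¹` gives `H₁(∂P) ≅ H₁(S² × S¹) ≅ ℤ`, hence `n = 0`
(`IsIntegralSurgery.nonempty_addEquiv_singularHomology_one_int_iff`); transporting the surgery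
presentation to `S² × S¹` (`isIntegralSurgery_sphereTwo_prod_sphereOne_of_diffeomorph`) and
applying Property R, `K` is the unknot, and `hT` closes `P` up to `S⁴`.
Gompf–Scharlemann–Thompson 2010, Prop. 2.2 (`n = 1`) and Thm. 1.1; Gabai 1987, Remark 8.5.
(Companion of the tree's
`propertyR_exists_isBoundaryGluing_sphere_four_of_leaves`, which goes through the model-free genus
clause of Gabai's Cor. 8.3 instead.)
[cite: GompfScharlemannThompson2010, Prop. 2.2 and Thm. 1.1]
[cite: GabaiJDG1987, Cor. 8.3 and Remark 8.5] -/
theorem propertyR_half_of_propertyR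
    (hPR : Literature.Topology.FourManifolds.isUnknot_of_isIntegralSurgery_zero)
    (hT : exists_framedKnot_of_hasHandleDecomposition_oneZeroOne) :
    propertyR_exists_isBoundaryGluing_sphere_four := by
  intro P _ _ _ _ _ _ hP bP hbd
  obtain ⟨V, _, _, _, _, _, _, _, bV, hV, hoV, ⟨ψ⟩⟩ := hbd
  -- the framed knot `(K, n)` with `∂P = S³ₙ(K)` and the closing clause
  obtain ⟨K, n, hsurg, hclose⟩ := hT P hP bP
  -- `∂P ≅ ∂V ≅ S² × S¹`
  obtain ⟨e⟩ :=
    nonempty_diffeomorph_boundary_sphereTwo_prod_of_handleCount_one_one_holds V hV hoV bV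
  let θ := ψ.trans e
  -- homology: `H₁(∂P) ≅ H₁(S² × S¹) ≅ ℤ`, so `n = 0`
  have hH : Nonempty
      (Literature.AlgebraicTopology.SingularHomology.singularHomology ℤ ℤ bP.carrier 1 ≃+ ℤ) := by
    obtain ⟨f⟩ := nonempty_addEquiv_singularHomology_one_sphereTwo_prod_sphereOne
    exact ⟨(Literature.AlgebraicTopology.SingularHomology.singularHomology.equivOfHomeomorph ℤ ℤ
      θ.toHomeomorph 1).toAddEquiv.trans f⟩
  obtain rfl : n = 0 := hsurg.nonempty_addEquiv_singularHomology_one_int_iff.1 hH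
  -- Property R on the transported presentation `S² × S¹ = S³₀(K)`
  have hU : K.IsUnknot := hPR K (isIntegralSurgery_sphereTwo_prod_sphereOne_of_diffeomorph hsurg θ)
  -- the standard closing
  exact hclose hU rfl

/-! ### (3) The stub: Property R closes the trace, gluing form -/

/-- **Stub `stub_propertyRGluing` (Property R closes the trace, GLUING FORM), conditional on the
named facts `hPR` (Gabai's Property R, `isUnknot_of_isIntegralSurgery_zero`), `hLP`
(Laudenbach–Poénaru, `exists_diffeomorph_comp_incl_eq`) and `hT` (the trace bridge,
`exists_framedKnot_of_hasHandleDecomposition_oneZeroOne`).**  A closed smooth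
`4`-manifold `X = P ∪_φ V` glued from a compact `P` with an adapted Morse function of indices
`≤ 2` and profile `(1,0,1)` (a knot trace `X_n(K)`) and a compact connected orientable `V` with an
adapted Morse function of indices `≤ 1` and profile `(1,1)` (`≅ S¹ × B³`) is diffeomorphic to
`S⁴`: the Morse data are handle decompositions (`hasHandleDecomposition_oneZeroOne`,
`hasHandleDecomposition_oneOne`), the Property R half holds (`propertyR_half_of_propertyR`), and
Gompf–Scharlemann–Thompson's Prop. 9.2 for one `2`-handle
(`nonempty_diffeomorph_sphere_of_isBoundaryGluing_oneTwoHandle_of_facts`: UNIQ₄ and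
Laudenbach–Poénaru with uniqueness of gluings) concludes.  The statement after the three
hypotheses is VERBATIM the registered stub (and crux 4's `stub_propertyRClosing`).
[cite: GompfScharlemannThompson2010, Thm. 1.1 and proof of Prop. 9.2 (case n = 1)]
[cite: GabaiJDG1987, Cor. 8.3] [cite: LaudenbachPoenaruBSMF1972, main theorem]
[cite: Kirby1989, Ch. I §1 and §2 (p. 8)] -/
theorem stub_propertyRGluing
    (hPR : Literature.Topology.FourManifolds.isUnknot_of_isIntegralSurgery_zero)
    (hLP : exists_diffeomorph_comp_incl_eq.{0})
    (hT : exists_framedKnot_of_hasHandleDecomposition_oneZeroOne) :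
    ∀ (P : Type) [TopologicalSpace P] [T2Space P] [SecondCountableTopology P]
      [ChartedSpace (EuclideanHalfSpace 4) P] [IsManifold (𝓡∂ 4) ∞ P] [CompactSpace P] (g : P → ℝ),
      IsMorseAdapted (𝓡∂ 4) g →
      (∀ z, IsMCriticalPt (𝓡∂ 4) g z → morseIndex (𝓡∂ 4) g z ≤ 2) →
      (criticalSetOfIndex (𝓡∂ 4) g 0).ncard = 1 → criticalSetOfIndex (𝓡∂ 4) g 1 = ∅ →
      (criticalSetOfIndex (𝓡∂ 4) g 2).ncard = 1 →
      ∀ (V : Type) [TopologicalSpace V] [T2Space V] [SecondCountableTopology V]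
      [ChartedSpace (EuclideanHalfSpace 4) V] [IsManifold (𝓡∂ 4) ∞ V] [CompactSpace V] [ConnectedSpace V],
      (∃ f : V → ℝ, IsMorseAdapted (𝓡∂ 4) f ∧
          (∀ z, IsMCriticalPt (𝓡∂ 4) f z → morseIndex (𝓡∂ 4) f z ≤ 1) ∧
          (criticalSetOfIndex (𝓡∂ 4) f 0).ncard = 1 ∧ (criticalSetOfIndex (𝓡∂ 4) f 1).ncard = 1) →
      IsOrientable (𝓡∂ 4) V →
      ∀ (bP : BoundaryData (𝓡∂ 4) P (𝓡 3)) (bV : BoundaryData (𝓡∂ 4) V (𝓡 3))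
        (φ : bP.carrier ≃ₘ⟮𝓡 3, 𝓡 3⟯ bV.carrier)
        (X : Type) [TopologicalSpace X] [T2Space X] [SecondCountableTopology X] [CompactSpace X]
      [ChartedSpace (EuclideanSpace ℝ (Fin 4)) X] [IsManifold (𝓡 4) ∞ X],
      IsBoundaryGluing bP bV φ (𝓡 4) X →
      Nonempty (X ≃ₘ⟮𝓡 4, 𝓡 4⟯ Metric.sphere (0 : EuclideanSpace ℝ (Fin 5)) 1) := by
  intro P _ _ _ _ _ _ g hg hle h0 h1 h2 V _ _ _ _ _ _ _ hVf hoV bP bV φ X _ _ _ _ _ _ hX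
  obtain ⟨f, hf, hfle, hf0, hf1⟩ := hVf
  exact nonempty_diffeomorph_sphere_of_isBoundaryGluing_oneTwoHandle_of_facts
    (propertyR_half_of_propertyR hPR hT) hLP P V
    (hasHandleDecomposition_oneZeroOne hg hle h0 h1 h2)
    (hasHandleDecomposition_oneOne hf hfle hf0 hf1) hoV hX

/-- The conditional stub is exactly `hPR → hLP → hT →` (the registered statement, verbatim). -/
example : Literature.Topology.FourManifolds.isUnknot_of_isIntegralSurgery_zero →
    exists_diffeomorph_comp_incl_eq.{0} →
    exists_framedKnot_of_hasHandleDecomposition_oneZeroOne →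
    ∀ (P : Type) [TopologicalSpace P] [T2Space P] [SecondCountableTopology P]
      [ChartedSpace (EuclideanHalfSpace 4) P] [IsManifold (𝓡∂ 4) ∞ P] [CompactSpace P] (g : P → ℝ),
      IsMorseAdapted (𝓡∂ 4) g →
      (∀ z, IsMCriticalPt (𝓡∂ 4) g z → morseIndex (𝓡∂ 4) g z ≤ 2) →
      (criticalSetOfIndex (𝓡∂ 4) g 0).ncard = 1 → criticalSetOfIndex (𝓡∂ 4) g 1 = ∅ →
      (criticalSetOfIndex (𝓡∂ 4) g 2).ncard = 1 →
      ∀ (V : Type) [TopologicalSpace V] [T2Space V] [SecondCountableTopology V]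
      [ChartedSpace (EuclideanHalfSpace 4) V] [IsManifold (𝓡∂ 4) ∞ V] [CompactSpace V] [ConnectedSpace V],
      (∃ f : V → ℝ, IsMorseAdapted (𝓡∂ 4) f ∧
          (∀ z, IsMCriticalPt (𝓡∂ 4) f z → morseIndex (𝓡∂ 4) f z ≤ 1) ∧
          (criticalSetOfIndex (𝓡∂ 4) f 0).ncard = 1 ∧ (criticalSetOfIndex (𝓡∂ 4) f 1).ncard = 1) →
      IsOrientable (𝓡∂ 4) V →
      ∀ (bP : BoundaryData (𝓡∂ 4) P (𝓡 3)) (bV : BoundaryData (𝓡∂ 4) V (𝓡 3))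
        (φ : bP.carrier ≃ₘ⟮𝓡 3, 𝓡 3⟯ bV.carrier)
        (X : Type) [TopologicalSpace X] [T2Space X] [SecondCountableTopology X] [CompactSpace X]
      [ChartedSpace (EuclideanSpace ℝ (Fin 4)) X] [IsManifold (𝓡 4) ∞ X],
      IsBoundaryGluing bP bV φ (𝓡 4) X →
      Nonempty (X ≃ₘ⟮𝓡 4, 𝓡 4⟯ Metric.sphere (0 : EuclideanSpace ℝ (Fin 5)) 1) :=
  stub_propertyRGluing

end Summit.SmoothPoincare4.SmoothPoincare4.Theorems.AcyclicBisectionRigidity.ExchangeRecognition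

end
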